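import Summits.CriticalPhenomena.PercolationContinuityZ3.Theorems.PercNearOneGluingNoHeavyLowerTailSunflowerCappedPendantOneNormalised
import HarnessLib

/-!
# `NoHeavyLowerTail` (crux stmt-CriticalPhenomena-4575), abstract sunflower cubic: the capped pendant lemma WITH ONE ALLOWANCE —
# part 2: (RES0′) for all `n` for every family in which all petals but one have `βg ≤ a₀·vv` (e.g. all but one have `m = b`)

Support file (seat `prim-ineq-prove-1` gen 62; `--supports stmt-CriticalPhenomena-4575`).  No `sorry`, no named facts.
Memo: run/shared/lean/prim/prim-ineq-prove-1/FINDING-CPL-prove1-g61.md §5.1 (the plan) and FINDING-TBERN-prove1-g62.md §1.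
Part 1 (`…SunflowerCappedPendantOneNormalised`) has the normalised bound `normalised_bound_one` (pendant proof with
`Pendant.final_two` replaced by `LinkedCurrency.one_allowance_final`).  Here:
* `cappedPendant_of_one` — the conclusion of `CappedPendant s t b β V` for every family with at most one `j` violating `βg_j ≤ a₀vv_j`
  (the allowance `a₀Y_P ≤ βZ_P` of the merged `u`-heavy class then holds: every other petal has `y_j ≤ z_j`, the exceptional one has
  `a₀y ≤ βz` from `m ≤ vv`);
* `cappedPendant_of_one_free` — in particular for every family with at most one `j` with `m_j ≠ b` (`m_j = b` gives
  `βg_j = β((1−s)b + s vv_j) ≤ a₀vv_j` because `β ≤ vv_j`);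
* `res0_of_one_free` — the model corollary (dictionary of `res0_of_cappedPendant`): the sharp (RES0′) `∏ G_j ≤ (g*)^(|S|−1)·a` for
  every `n` and every family in which at most one petal has `g_j ≠ α₀₁` (budgets `(BȲ)`, `(Bh)`, `(BH)`, links `g ≤ k`, `g ≤ h`,
  cap `h ≤ 1`).
-/

noncomputable section

namespace Summit.CriticalPhenomena.PercolationContinuityZ3.Theorems.SunflowerPartition

namespace SafeCalc

namespace LinkedCurrency

open Finset Pendant

variable {κ : Type*}

/-- **THE CAPPED PENDANT LEMMA WITH ONE ALLOWANCE.**  Under the hypotheses of `CappedPendant s t b β V` (`0 < b ≤ β`,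
`s, t ∈ [0,1]`; `b ≤ u_j ≤ 1`, `β ≤ vv_j ≤ V`, `b ≤ m_j ≤ min(u_j, vv_j)`; budgets `∏u ≤ b^(n−1)`, `∏vv ≤ β^(n−1)V`,
`∏((1−s)m + s vv) ≤ a₀^(n−1)V`), IF all petals but at most one satisfy `β·((1−s)m_j + s vv_j) ≤ a₀·vv_j` (`a₀ = (1−s)b + sβ`),
then `∏ (st + s(1−t)vv_j + (1−s)t u_j + (1−s)(1−t)m_j) ≤ (st + s(1−t)β + (1−s)b)^(n−1)·(t + (1−t)V)`. [this work] -/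
theorem cappedPendant_of_one {n : ℕ} {s t b β V : ℝ} (hb : 0 < b) (hbβ : b ≤ β) (hs : 0 ≤ s) (hs1 : s ≤ 1)
    (ht : 0 ≤ t) (ht1 : t ≤ 1) (u vv m : Fin n → ℝ) (hub : ∀ j, b ≤ u j) (hvβ : ∀ j, β ≤ vv j)
    (hv1 : ∀ j, vv j ≤ V) (hmb : ∀ j, b ≤ m j) (hmu : ∀ j, m j ≤ u j) (hmv : ∀ j, m j ≤ vv j)
    (hpu : ∏ j, u j ≤ b ^ (n - 1)) (hpv : ∏ j, vv j ≤ β ^ (n - 1) * V)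
    (hpg : ∏ j, ((1 - s) * m j + s * vv j) ≤ ((1 - s) * b + s * β) ^ (n - 1) * V)
    (hone : ∃ j₀, ∀ j, j ≠ j₀ → β * ((1 - s) * m j + s * vv j) ≤ ((1 - s) * b + s * β) * vv j) :
    ∏ j, (s * t + s * (1 - t) * vv j + (1 - s) * t * u j + (1 - s) * (1 - t) * m j) ≤
      (s * t + s * (1 - t) * β + (1 - s) * b) ^ (n - 1) * (t + (1 - t) * V) := by
  classical
  have hs' : 0 ≤ 1 - s := sub_nonneg.2 hs1
  have ht' : 0 ≤ 1 - t := sub_nonneg.2 ht1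
  have hβ : 0 < β := hb.trans_le hbβ
  set a₀ : ℝ := (1 - s) * b + s * β with ha₀
  have ha₀b : b ≤ a₀ := by
    have := mul_le_mul_of_nonneg_left hbβ hs
    rw [ha₀]; linarith
  have ha₀pos : 0 < a₀ := hb.trans_le ha₀b
  rcases Nat.eq_zero_or_pos n with hn | hn
  · -- `n = 0`: the `vv`-budget forces `1 ≤ V`
    subst hn
    simp only [univ_eq_empty, prod_empty, Nat.zero_sub, pow_zero, one_mul] at hpv ⊢
    nlinarith
  have hV : β ≤ V := (hvβ ⟨0, hn⟩).trans (hv1 ⟨0, hn⟩)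
  -- the normalised variables
  set g : Fin n → ℝ := fun j => (1 - s) * m j + s * vv j with hg
  set x : Fin n → ℝ := fun j => u j / b with hx
  set y : Fin n → ℝ := fun j => g j / a₀ with hy
  set z : Fin n → ℝ := fun j => vv j / β with hz
  have hga : ∀ j, a₀ ≤ g j := fun j => by
    have e1 := mul_le_mul_of_nonneg_left (hmb j) hs'
    have e2 := mul_le_mul_of_nonneg_left (hvβ j) hs
    simp only [hg, ha₀]; linarith
  have hx1 : ∀ j, 1 ≤ x j := fun j => by simp only [hx]; rw [le_div_iff₀ hb, one_mul]; exact hub j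
  have hy1 : ∀ j, 1 ≤ y j := fun j => by simp only [hy]; rw [le_div_iff₀ ha₀pos, one_mul]; exact hga j
  have hz1 : ∀ j, 1 ≤ z j := fun j => by simp only [hz]; rw [le_div_iff₀ hβ, one_mul]; exact hvβ j
  -- the factors and the target in terms of `ψ`
  have hfac : ∀ j, s * t + s * (1 - t) * vv j + (1 - s) * t * u j + (1 - s) * (1 - t) * m j =
      pfun (s * t) (t * (1 - s) * b) ((1 - t) * a₀) (x j) (y j) := by
    intro j; simp only [pfun, hx, hy, hg]; field_simp; ring
  have hc : s * t + s * (1 - t) * β + (1 - s) * b = pfun (s * t) (t * (1 - s) * b) ((1 - t) * a₀) 1 1 := by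
    simp only [pfun, ha₀]; ring
  -- budgets
  have hpow : ∀ (c : ℝ), c ^ n = c * c ^ (n - 1) := fun c => by
    conv_lhs => rw [show n = (n - 1) + 1 by omega, pow_succ]
    ring
  have hPx : b * ∏ j, x j ≤ 1 := by
    simp only [hx]
    rw [prod_div_distrib, prod_const, card_univ, Fintype.card_fin, hpow b, mul_div_assoc', div_le_one (by positivity)]
    exact mul_le_mul_of_nonneg_left hpu hb.le
  have hPy : a₀ * ∏ j, y j ≤ V := by
    simp only [hy]
    rw [prod_div_distrib, prod_const, card_univ, Fintype.card_fin, hpow a₀, mul_div_assoc',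
      div_le_iff₀ (by positivity)]
    calc a₀ * ∏ j, g j ≤ a₀ * (a₀ ^ (n - 1) * V) := mul_le_mul_of_nonneg_left hpg ha₀pos.le
      _ = V * (a₀ * a₀ ^ (n - 1)) := by ring
  have hPz : β * ∏ j, z j ≤ V := by
    simp only [hz]
    rw [prod_div_distrib, prod_const, card_univ, Fintype.card_fin, hpow β, mul_div_assoc',
      div_le_iff₀ (by positivity)]
    calc β * ∏ j, vv j ≤ β * (β ^ (n - 1) * V) := mul_le_mul_of_nonneg_left hpv hβ.le
      _ = V * (β * β ^ (n - 1)) := by ring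
  -- the links
  have hgb : ∀ j, g j * b ≤ (1 - s) * u j * b + s * vv j * b := fun j => by
    have e1 := mul_le_mul_of_nonneg_left (hmu j) hs'
    have e2 : g j ≤ (1 - s) * u j + s * vv j := by simp only [hg]; linarith
    have e3 := mul_le_mul_of_nonneg_right e2 hb.le
    linarith
  have hxz : ∀ j, x j < y j → x j ≤ z j := by
    intro j hlt
    simp only [hx, hy, hz] at hlt ⊢
    rw [div_lt_div_iff₀ hb ha₀pos] at hlt
    rw [div_le_div_iff₀ hb hβ]
    have h2 : u j * a₀ = (1 - s) * u j * b + s * (u j * β) := by rw [ha₀]; ring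
    have h3 : s * (u j * β) < s * (vv j * b) := by linarith [hgb j]
    exact (lt_of_mul_lt_mul_left h3 hs).le
  have hlink : ∀ j, x j < y j → a₀ * y j ≤ lfun b β s (x j) (z j) := by
    intro j _
    have e0 : a₀ * y j = g j := by simp only [hy]; rw [mul_div_cancel₀ _ ha₀pos.ne']
    have e1 : lfun b β s (x j) (z j) = (1 - s) * u j + s * vv j := by
      simp only [lfun, hx, hz]; field_simp
    have e2 := mul_le_mul_of_nonneg_left (hmu j) hs'
    rw [e0, e1]; simp only [hg]; linarith
  have hL2 : ∀ j, a₀ * y j ≤ β * z j := by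
    intro j
    have e0 : a₀ * y j = g j := by simp only [hy]; rw [mul_div_cancel₀ _ ha₀pos.ne']
    have e1 : β * z j = vv j := by simp only [hz]; rw [mul_div_cancel₀ _ hβ.ne']
    have e2 := mul_le_mul_of_nonneg_left (hmv j) hs'
    rw [e0, e1]; simp only [hg]; linarith
  have hone' : ∃ j₀, ∀ j, j ≠ j₀ → y j ≤ z j := by
    obtain ⟨j₀, hj₀⟩ := hone
    refine ⟨j₀, fun j hj => ?_⟩
    have h1 := hj₀ j hj
    simp only [hy, hz]
    rw [div_le_div_iff₀ ha₀pos hβ]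
    simp only [hg]; linarith
  rw [prod_congr rfl fun j _ => hfac j, hc]
  exact normalised_bound_one hn hb hbβ hs hs1 ht ht1 x y z hx1 hy1 hz1 hPx hPy hPz hxz hlink hL2 hone'

/-- **One free-`g` petal.**  The conclusion of the capped pendant lemma holds for every family in which at most one petal has
`m_j ≠ b` (a petal with `m_j = b` has `g_j = (1−s)b + s vv_j` and `βg_j ≤ a₀vv_j` because `β ≤ vv_j`). [this work] -/
theorem cappedPendant_of_one_free {n : ℕ} {s t b β V : ℝ} (hb : 0 < b) (hbβ : b ≤ β) (hs : 0 ≤ s) (hs1 : s ≤ 1)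
    (ht : 0 ≤ t) (ht1 : t ≤ 1) (u vv m : Fin n → ℝ) (hub : ∀ j, b ≤ u j) (hvβ : ∀ j, β ≤ vv j)
    (hv1 : ∀ j, vv j ≤ V) (hmb : ∀ j, b ≤ m j) (hmu : ∀ j, m j ≤ u j) (hmv : ∀ j, m j ≤ vv j)
    (hpu : ∏ j, u j ≤ b ^ (n - 1)) (hpv : ∏ j, vv j ≤ β ^ (n - 1) * V)
    (hpg : ∏ j, ((1 - s) * m j + s * vv j) ≤ ((1 - s) * b + s * β) ^ (n - 1) * V)
    (hone : ∃ j₀, ∀ j, j ≠ j₀ → m j = b) :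
    ∏ j, (s * t + s * (1 - t) * vv j + (1 - s) * t * u j + (1 - s) * (1 - t) * m j) ≤
      (s * t + s * (1 - t) * β + (1 - s) * b) ^ (n - 1) * (t + (1 - t) * V) := by
  refine cappedPendant_of_one hb hbβ hs hs1 ht ht1 u vv m hub hvβ hv1 hmb hmu hmv hpu hpv hpg ?_
  obtain ⟨j₀, hj₀⟩ := hone
  refine ⟨j₀, fun j hj => ?_⟩
  rw [hj₀ j hj]
  have hs' : 0 ≤ 1 - s := sub_nonneg.2 hs1
  have h1 : (1 - s) * b * β ≤ (1 - s) * b * vv j := mul_le_mul_of_nonneg_left (hvβ j) (mul_nonneg hs' hb.le)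
  nlinarith

/-- **(RES0′) FOR ALL `n` WITH AT MOST ONE PETAL OFF THE `g`-FLOOR** (model form; the dictionary of
`res0_of_cappedPendant`).  Coins `τ, σ, s ∈ [0,1]`, floors `0 < α₀₀ ≤ α₀₁ ≤ α₁₁`; petals `j ∈ S` (nonempty) with
`α₀₀ ≤ y_j`, `α₀₁ ≤ k_j`, `α₀₁ ≤ g_j ≤ min(k_j, h_j)`, `α₁₁ ≤ h_j ≤ 1` (no caps on `y`, `k`); budgets `(BȲ)`, `(Bh)`, `(BH)`; and `g_j = α₀₁` for
all `j ∈ S` but at most one.  Then `∏_S G_j ≤ (g*)^(|S|−1)·a`, `a = G(full)`. [this work] -/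
theorem res0_of_one_free [DecidableEq κ] {τ σ s α00 α01 α11 : ℝ} (hτ0 : 0 ≤ τ) (hτ1 : τ ≤ 1) (hσ0 : 0 ≤ σ)
    (hσ1 : σ ≤ 1) (hs0 : 0 ≤ s) (hs1 : s ≤ 1) (hα0 : 0 < α00) (h01 : α00 ≤ α01) (h11 : α01 ≤ α11)
    (S : Finset κ) (hS : S.Nonempty) (y k gc h : κ → ℝ)
    (hy : ∀ j ∈ S, α00 ≤ y j) (hk : ∀ j ∈ S, α01 ≤ k j) (hg : ∀ j ∈ S, α01 ≤ gc j) (hgk : ∀ j ∈ S, gc j ≤ k j)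
    (hgh : ∀ j ∈ S, gc j ≤ h j) (hh : ∀ j ∈ S, α11 ≤ h j) (hh1 : ∀ j ∈ S, h j ≤ 1)
    (hone : ∃ j₀, ∀ j ∈ S, j ≠ j₀ → gc j = α01)
    (hBY : ∏ j ∈ S, ((1 - s) * y j + s * k j) ≤ ((1 - s) * α00 + s * α01) ^ (S.card - 1))
    (hBh : ∏ j ∈ S, h j ≤ α11 ^ (S.card - 1))
    (hBH : ∏ j ∈ S, ((1 - σ) * gc j + σ * h j) ≤ ((1 - σ) * α01 + σ * α11) ^ (S.card - 1)) :
    ∏ j ∈ S, (τ * σ + (1 - τ) * (1 - s) * α00 + τ * (1 - σ) * ((1 - s) * y j + s * k j) +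
        s * (1 - τ) * ((1 - σ) * gc j + σ * h j)) ≤
      (τ * σ + (1 - τ) * (1 - s) * α00 + τ * (1 - σ) * ((1 - s) * α00 + s * α01) +
        s * (1 - τ) * ((1 - σ) * α01 + σ * α11)) ^ (S.card - 1) *
        (τ * σ + (1 - τ) * (1 - s) * α00 + τ * (1 - σ) + s * (1 - τ)) := by
  classical
  have hs' : 0 ≤ 1 - s := sub_nonneg.2 hs1
  have hσ' : 0 ≤ 1 - σ := sub_nonneg.2 hσ1
  have hα01 : 0 < α01 := hα0.trans_le h01
  have hα11 : 0 < α11 := hα01.trans_le h11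
  set e := S.equivFin with he
  have mem : ∀ i : Fin S.card, ((e.symm i : S) : κ) ∈ S := fun i => (e.symm i).2
  set u : Fin S.card → ℝ := fun i => (1 - s) * y ((e.symm i : S) : κ) + s * k ((e.symm i : S) : κ) with hu
  set vv : Fin S.card → ℝ := fun i => s * h ((e.symm i : S) : κ) + (1 - s) * α00 with hvv
  set m : Fin S.card → ℝ := fun i => s * gc ((e.symm i : S) : κ) + (1 - s) * α00 with hm
  set b : ℝ := (1 - s) * α00 + s * α01 with hb
  set β : ℝ := s * α11 + (1 - s) * α00 with hβ
  set V : ℝ := s + (1 - s) * α00 with hV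
  have hbpos : 0 < b := by rw [hb]; nlinarith
  have hbβ : b ≤ β := by rw [hb, hβ]; nlinarith
  have hbH : 0 < (1 - σ) * α01 + σ * α11 := by nlinarith
  have hBvv : ∏ i, vv i ≤ β ^ (S.card - 1) * V := by
    have h1 := prod_wavg_le hs0 hs1 hα0.le hα11 S hS h hh hBh
    have h2 : ∏ i, vv i = ∏ j ∈ S, (s * h j + (1 - s) * α00) := by
      rw [hvv, ← prod_eq_prod_fin_equiv S (fun j => s * h j + (1 - s) * α00)]
    rw [h2, hβ, hV]; exact h1
  have hBg : ∏ i, ((1 - σ) * m i + σ * vv i) ≤ ((1 - σ) * b + σ * β) ^ (S.card - 1) * V := by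
    have h1 := prod_wavg_le hs0 hs1 hα0.le hbH S hS (fun j => (1 - σ) * gc j + σ * h j)
      (fun j hj => by nlinarith [hg j hj, hh j hj]) hBH
    have h2 : ∏ i, ((1 - σ) * m i + σ * vv i) = ∏ j ∈ S, (s * ((1 - σ) * gc j + σ * h j) + (1 - s) * α00) := by
      rw [hm, hvv, prod_eq_prod_fin_equiv S (fun j => s * ((1 - σ) * gc j + σ * h j) + (1 - s) * α00)]
      exact Fintype.prod_congr _ _ (fun i => by ring)
    have h3 : s * ((1 - σ) * α01 + σ * α11) + (1 - s) * α00 = (1 - σ) * b + σ * β := by rw [hb, hβ]; ring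
    rw [h2, ← h3, hV]; exact h1
  have hBu : ∏ i, u i ≤ b ^ (S.card - 1) := by
    rw [hu, hb, ← prod_eq_prod_fin_equiv S (fun j => (1 - s) * y j + s * k j)]; exact hBY
  -- the exceptional index, transported to `Fin S.card`
  have hone' : ∃ i₀ : Fin S.card, ∀ i, i ≠ i₀ → m i = b := by
    obtain ⟨j₀, hj₀⟩ := hone
    by_cases hmem : j₀ ∈ S
    · refine ⟨e ⟨j₀, hmem⟩, fun i hi => ?_⟩
      have hne : ((e.symm i : S) : κ) ≠ j₀ := by
        intro hEq
        apply hi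
        have : (e.symm i : S) = ⟨j₀, hmem⟩ := Subtype.ext hEq
        rw [← this, Equiv.apply_symm_apply]
      show s * gc ((e.symm i : S) : κ) + (1 - s) * α00 = b
      rw [hj₀ _ (mem i) hne, hb]; ring
    · refine ⟨⟨0, Finset.card_pos.2 hS⟩, fun i _ => ?_⟩
      have hne : ((e.symm i : S) : κ) ≠ j₀ := fun hEq => hmem (hEq ▸ mem i)
      show s * gc ((e.symm i : S) : κ) + (1 - s) * α00 = b
      rw [hj₀ _ (mem i) hne, hb]; ring
  have key := cappedPendant_of_one_free (n := S.card) (s := σ) (t := τ) hbpos hbβ hσ0 hσ1 hτ0 hτ1 u vv m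
    (fun i => by show b ≤ u i; rw [hb, hu]; nlinarith [hy _ (mem i), hk _ (mem i)])
    (fun i => by show β ≤ vv i; rw [hβ, hvv]; nlinarith [hh _ (mem i)])
    (fun i => by show vv i ≤ V; rw [hV, hvv]; nlinarith [hh1 _ (mem i)])
    (fun i => by show b ≤ m i; rw [hb, hm]; nlinarith [hg _ (mem i)])
    (fun i => by show m i ≤ u i; rw [hm, hu]; nlinarith [hgk _ (mem i), hy _ (mem i)])
    (fun i => by show m i ≤ vv i; rw [hm, hvv]; nlinarith [hgh _ (mem i)])
    hBu hBvv hBg hone'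
  have e1 : ∏ j ∈ S, (τ * σ + (1 - τ) * (1 - s) * α00 + τ * (1 - σ) * ((1 - s) * y j + s * k j) +
        s * (1 - τ) * ((1 - σ) * gc j + σ * h j)) =
      ∏ i : Fin S.card, (σ * τ + σ * (1 - τ) * vv i + (1 - σ) * τ * u i + (1 - σ) * (1 - τ) * m i) := by
    rw [prod_eq_prod_fin_equiv S]
    refine Fintype.prod_congr _ _ (fun i => ?_)
    rw [hu, hvv, hm]; ring
  rw [e1]
  refine key.trans (le_of_eq ?_)
  rw [hb, hβ, hV]; ring

end LinkedCurrency

end SafeCalc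

end Summit.CriticalPhenomena.PercolationContinuityZ3.Theorems.SunflowerPartition
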